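import Mathlib

/-!
# ω-census (tpp lane): C5 — no C3-SATURATED TPP triple beats `Σ dᵢ³` in any `F × (N ⋊ C3)` of order `< 578` (statement only)

Contributed by the speedrun lane `tpp` (summit MatrixMultiplication), seat `sr-tpp-search-g20` (2026-08-23; source
`run/shared/lean/speedrun/tpp/sr-tpp-search-g20/lean/C5Statement.lean`, sha256 `5d4a96e8fa663358a031dd19919f7e9e3c7769ff2f6a6856c5c448915a16ecb4`, farm `lean check`
rc 0), restyled for the tree by seat `sr-tpp-search-g30` (2026-08-26: header; the `@[conjecture]` tag replaced by this prose — C5 is an OPEN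
conjecture of the lane (STRUCTURE.md §2, prereg P-003), typed as a `Prop`, asserted nowhere; statement unchanged).  Context: the lane's census
shows that NO group of order `< 168` has a single TPP triple beating `Σ dᵢ³` and that the least such order satisfies `168 ≤ N* ≤ 578`
(`Cyclic17Dihedral34Record.lean`: `C₁₇ × D₃₄`, `⟨18,8,8⟩`, `1152 > 1122`); every record and near-record found in `[168, 578]` is C3-saturated
or dihedral-doubled, whence the interest of C5.
Framing: lottery ticket; floor = certified bounds/negative ranges.  Nothing in this file is progress on `ω`; it records STRUCTURE of the small-group TPP census (lane documents `run/shared/lean/speedrun/tpp/STRUCTURE.md`, `WRITEUP-A.md`).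

Family T14: `G = F × (N ⋊ C3)`, `F`, `N` finite abelian, `C3 = ⟨g⟩` acting on `N` by an additive
automorphism `g` with `g³ = 1` (trivially on `F`), and the three sets are *saturated*: `S_i = X_i · C3` with
`X_i ⊂ F × N`, so `|S_i| = 3 |X_i|` and `|G| = 3 |F| |N|`.

By the saturated-triple criterion (RECORD-HUNT g17 §1, re-derived and validated in C3-FAMILY.md §1 (1.1)),
`(S_1, S_2, S_3)` has the triple product property in `G` iff `C3SatTPP g X₁ X₂ X₃` below holds, and
`D₃(G) = Σ (dim ρ)³ = |F| · (9 |N| − 6 · #{x ∈ N | g x = x})` (linear characters over the `g`-fixed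
characters, degree-3 irreducibles over the free orbits).  "Beats" means `|S_1||S_2||S_3| > D₃(G)`, i.e.
`27 |X₁||X₂||X₃| > D₃(G)`.  C5 says this never happens when `|G| < 578` (the order of the standing record
`Z17 × D34`).  Evidence: prereg/P-003.md SCORING (exact searches, α-bound theorems for `N = Z7, Z13`,
the no-loop-free-block lemma for `Z_{3^a}`, `J2`, `A4`-factors).
-/

namespace Summit.MatrixMultiplication.OmegaCensus.SpeedrunTPP

open Pointwise

variable {F N : Type} [AddCommGroup F] [DecidableEq F] [AddCommGroup N] [DecidableEq N]

/-- `g^k` acting on the `N`-coordinate of `F × N` (trivially on the label group `F`), applied to a finite set. -/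
def actC3 (g : N ≃+ N) (k : ℕ) (X : Finset (F × N)) : Finset (F × N) :=
  X.image (Prod.map id ((⇑g)^[k]))

/-- The saturated-triple criterion: (a) `X₁ + X₂ + X₃` is direct; (b) for every pair of exponents
`(k, l) ≠ (0, 0)` mod 3, `(X₁ + gᵏX₂ + gˡX₃) ∩ (gᵏX₁ + gˡX₂ + X₃) = ∅`. -/
def C3SatTPP (g : N ≃+ N) (X₁ X₂ X₃ : Finset (F × N)) : Prop :=
  Set.InjOn (fun p : (F × N) × (F × N) × (F × N) => p.1 + p.2.1 + p.2.2)
      ((↑X₁ : Set (F × N)) ×ˢ ((↑X₂ : Set (F × N)) ×ˢ (↑X₃ : Set (F × N))))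
  ∧ ∀ k l : Fin 3, (k, l) ≠ (0, 0) →
      Disjoint (X₁ + actC3 g k X₂ + actC3 g l X₃) (actC3 g k X₁ + actC3 g l X₂ + X₃)

/-- **C5.** No C3-saturated triple in any `F × (N ⋊ C3)` of order `< 578` beats `D₃`. -/
def NoC3SaturatedRecordBelow578 : Prop :=
  ∀ (F N : Type) [AddCommGroup F] [Fintype F] [DecidableEq F] [AddCommGroup N] [Fintype N] [DecidableEq N]
    (g : N ≃+ N), (∀ x : N, g (g (g x)) = x) →
    3 * Fintype.card F * Fintype.card N < 578 →
    ∀ X₁ X₂ X₃ : Finset (F × N), C3SatTPP g X₁ X₂ X₃ →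
      27 * X₁.card * X₂.card * X₃.card
        ≤ Fintype.card F * (9 * Fintype.card N - 6 * (Finset.univ.filter (fun x : N => g x = x)).card)

end Summit.MatrixMultiplication.OmegaCensus.SpeedrunTPP
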